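import Summits.BirchSwinnertonDyer.BirchSwinnertonDyer.Theorems.SignedLowerHalvesSmallImageLowerHalfBothSignsRttCharRoadE1LocalSquareInert
import HarnessLib

/-!
# Route `SignedLowerHalves`, crux L `SmallImageLowerHalfBothSigns` (stmt-BirchSwinnertonDyer-23599), line `rtt_w3` v12 — glue `charRoad_injTop`,
# LEAD: THE (I8) DATA OF `injTop_of_inputs` (wrapper step (W1) of memo `Lines/rtt_w3-GLUE-g7.md` §6)

WHY: the landed composition `SmallImageCharSignedSelmer.injTop_of_inputs` (`…RttCharRoadE1InjTopOfInputs.lean`, p770240) takes as (I8) the inert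
local square at `p` together with ONE local element `c ∈ Λ_∞ = localSubgroupOfEmb κ.kerSubgroup ι` restricting OUTSIDE `galRange K` (a shared
transversal for the corestrictions at every layer and at level `∞`), the cores data `e_n : N_n →ₜ* H_n ⊓ U`, `e_∞`, a section `e_∞'`, the
inclusions `incN n : N_∞ →ₜ* N_n`, and openness facts. This file CONSTRUCTS them (no hypothesis beyond the INJTOP binders `[K:ℚ] = 2`, `w = (p)`,
`p ≠ 2`).

HOW. §1 (the only non-formal point): from g17's `τ ∈ Γ_{ℚ_{v₀}}` with `res_ι τ ∉ U` (`U` of index `2`, `p` odd) an element of the KERNEL-level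
local group: the map `f = κ ∘ res_ι : Γ_{ℚ_{v₀}} → ℤ_p` is continuous on a compact group, so its image is closed, hence (density of `ℕ` in `ℤ_p`)
a `ℤ_p`-submodule; pick `σ` with `f σ = -f τ / 2` (`2 ∈ ℤ_pˣ`) and take `c = τ·σ²` (`f c = 0`; `σ² ∈ U` as `[Γ : U] = 2`). Arithmetically: `K_w = ℚ_{p²}`
is unramified and `ℚ_{p,∞}/ℚ_p` is pro-`p`, so `K_w ⊄ ℚ_{p,∞}`. §2 packages §1 with g17's square (`exists_localSquare_of_eq_span`). §3 the cores data
(identity maps between `U.subgroupOf H` and `H ⊓ U`, inclusions `N_∞ → N_n`); §4 continuity of the restricted orbit maps.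
THEOREMS ONLY; BSD / crux L / INJ_top are NOT proved here. [cite: NeukirchANT1999, II §7, §9] [cite: Washington1997, §13.1]
[cite: SerreGaloisCohomology1997, I §2.4, II §1.1]
-/

set_option linter.dupNamespace false -- D-0017: single-problem summit, the namespace repeats the problem name by design

noncomputable section

open scoped Classical

universe u

namespace Summit.BirchSwinnertonDyer.BirchSwinnertonDyer.Theorems.SmallImageCharSignedSelmer

open NumberField IsDedekindDomain Literature.NumberTheory.EllipticCurves Literature.NumberTheory.GaloisRepresentations Field WeierstrassCurve

/-! ## §1 A Frobenius-type element at level `∞` -/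

section KerLevel

variable {k : Type u} [Field k] [CharZero k] {p : ℕ} [hp : Fact p.Prime] (κ : ZpExtension k p) {U : Subgroup (absoluteGaloisGroup k)}
  {E : Type u} [Field E] [Algebra k E] (ι : AlgebraicClosure k →ₐ[k] AlgebraicClosure E)

omit [CharZero k] in
/-- `2` is a unit of `ℤ_p` for `p` odd (private copy; the tree has several file-local ones). [folklore] -/
private theorem isUnit_two_padicInt (hp2 : p ≠ 2) : IsUnit (2 : ℤ_[p]) := by
  rw [PadicInt.isUnit_iff]
  refine le_antisymm (PadicInt.norm_le_one _) (not_lt.1 fun h ↦ hp2 ?_)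
  have h' : ‖((2 : ℤ) : ℤ_[p])‖ < 1 := by exact_mod_cast h
  rw [PadicInt.norm_int_lt_one_iff_dvd] at h'
  exact ((Nat.prime_dvd_prime_iff_eq hp.out Nat.prime_two).1 (by exact_mod_cast h')).symm ▸ rfl

/-- ★ **A Frobenius-type element at level `∞`.** For `p` odd, `U ≤ Γ_k` of index `2` and ONE `τ ∈ Γ_E` with `res_ι τ ∉ U`, the kernel-level
local group `Λ_∞ = localSubgroupOfEmb κ.kerSubgroup ι` contains some `c` with `res_ι c ∉ U`: the image of the continuous map
`f = κ ∘ res_ι : Γ_E → ℤ_p` is compact, hence closed, hence a `ℤ_p`-submodule (`ℕ` is dense in `ℤ_p`); with `f σ = -f τ / 2` the element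
`c = τ σ²` has `f c = 0` and `res_ι c = res_ι τ · (res_ι σ)² ∉ U` (`(res_ι σ)² ∈ U`). In D3-W: `U = galRange K`, `E = ℚ_p`, `p` inert in `K`
(`K_w` unramified is not inside the totally ramified `ℚ_{p,∞}`). [cite: NeukirchANT1999, II §7, §9] [cite: Washington1997, §13.1] -/
theorem exists_mem_localSubgroupOfEmb_kerSubgroup_not_mem (hp2 : p ≠ 2) (hU : U.index = 2) {τ : absoluteGaloisGroup E}
    (hτ : resGalOfEmb ι τ ∉ U) : ∃ c ∈ localSubgroupOfEmb κ.kerSubgroup ι, resGalOfEmb ι c ∉ U := by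
  haveI : CharZero E := charZero_of_injective_algebraMap (algebraMap k E).injective
  -- the continuous additive map `f = κ ∘ res_ι`
  set f : absoluteGaloisGroup E → ℤ_[p] := fun x ↦ Multiplicative.toAdd (κ (resGalOfEmb ι x)) with hf
  have hfc : Continuous f := continuous_toAdd.comp ((map_continuous κ).comp (resGalOfEmb ι).continuous_toFun)
  have hfpow : ∀ (x : absoluteGaloisGroup E) (n : ℕ), f (x ^ n) = (n : ℤ_[p]) * f x := fun x n ↦ by
    simp only [hf, map_pow, toAdd_pow, nsmul_eq_mul]
  have hfmul : ∀ x y : absoluteGaloisGroup E, f (x * y) = f x + f y := fun x y ↦ by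
    simp only [hf, map_mul, toAdd_mul]
  -- its image is closed, hence a `ℤ_p`-submodule
  have hR : IsClosed (Set.range f) := (isCompact_range hfc).isClosed
  have hmem : ∀ l : ℤ_[p], l * f τ ∈ Set.range f := fun l ↦ by
    have h1 : l ∈ closure (Set.range (Nat.cast : ℕ → ℤ_[p])) := PadicInt.denseRange_natCast l
    have h3 : Set.MapsTo (fun m : ℤ_[p] ↦ m * f τ) (Set.range (Nat.cast : ℕ → ℤ_[p])) (Set.range f) := by
      rintro _ ⟨n, rfl⟩
      exact ⟨τ ^ n, hfpow τ n⟩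
    have h4 := map_mem_closure (continuous_id.mul continuous_const) h1 h3
    rwa [hR.closure_eq] at h4
  -- `σ` with `f σ = -f τ / 2`
  have h2 := isUnit_two_padicInt hp2
  obtain ⟨σ, hσ⟩ := hmem (-(((h2.unit⁻¹ : ℤ_[p]ˣ) : ℤ_[p])))
  refine ⟨τ * σ ^ 2, ?_, ?_⟩
  · rw [mem_localSubgroupOfEmb_iff, ZpExtension.mem_kerSubgroup]
    apply Multiplicative.toAdd.injective
    rw [toAdd_one]
    change f (τ * σ ^ 2) = 0
    rw [hfmul, hfpow, hσ]
    have hinv : (2 : ℤ_[p]) * ((h2.unit⁻¹ : ℤ_[p]ˣ) : ℤ_[p]) = 1 := h2.mul_val_inv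
    linear_combination (-(f τ)) * hinv
  · rw [map_mul, map_pow]
    intro h
    have hσ2 : resGalOfEmb ι σ ^ 2 ∈ U := by
      rw [pow_two]
      exact Subgroup.mul_self_mem_of_index_two hU _
    exact hτ ((U.mul_mem_cancel_right hσ2).1 h)

end KerLevel

/-! ## §2 The local square at the inert prime, with a kernel-level Frobenius-type element -/

section Inert

variable (K : Type) [Field K] [NumberField K] {p : ℕ} [hp : Fact p.Prime]
  (v₀ : HeightOneSpectrum (𝓞 ℚ)) (w : HeightOneSpectrum (𝓞 K)) (hw : w.asIdeal = Ideal.span {(p : 𝓞 K)})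

include hw in
/-- ★ **The (I8) square at the inert prime.** For `[K : ℚ] = 2`, `w = (p)` over `v₀`, `p` odd and any `ℤ_p`-extension `κ` of `ℚ`: the
square `(ι, ι₂, hcompat, hι₂, hfixU)` of g17's `exists_localSquare_of_eq_span` AND one `c ∈ localSubgroupOfEmb κ.kerSubgroup ι` with
`res_ι c ∉ galRange K` (§1 with `[Γ_ℚ : galRange K] = 2`). Exactly the data `(v₀ hv₀ w ι ι₂ hcompat hι₂ hfixU) … (hc hcU)` of `injTop_of_inputs`.
[cite: SerreGaloisCohomology1997, II §1.1] [cite: NeukirchANT1999, II §8–§9] [cite: Washington1997, §13.1] -/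
theorem exists_localSquare_ker_of_eq_span (hK2 : Module.finrank ℚ K = 2) [w.asIdeal.LiesOver v₀.asIdeal] (hp2 : p ≠ 2)
    (κ : ZpExtension ℚ p) :
    ∃ (ι : AlgebraicClosure ℚ →ₐ[ℚ] AlgebraicClosure (v₀.adicCompletion ℚ))
      (ι₂ : AlgebraicClosure (v₀.adicCompletion ℚ) ≃+* AlgebraicClosure (w.adicCompletion K)),
      (∀ z : AlgebraicClosure ℚ, closureEmb (K := K) (w.adicCompletion K) (closureEmb (K := ℚ) K z) = ι₂ (ι z)) ∧
      (∀ y : v₀.adicCompletion ℚ, ι₂ (algebraMap (v₀.adicCompletion ℚ) (AlgebraicClosure (v₀.adicCompletion ℚ)) y) =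
        algebraMap (w.adicCompletion K) (AlgebraicClosure (w.adicCompletion K)) (adicCompletionMap (K := ℚ) K v₀ w y)) ∧
      (∀ h : absoluteGaloisGroup (v₀.adicCompletion ℚ), resGalOfEmb ι h ∈ galRange (K := ℚ) K → ∀ y : w.adicCompletion K,
        (show AlgebraicClosure (v₀.adicCompletion ℚ) ≃ₐ[v₀.adicCompletion ℚ] AlgebraicClosure (v₀.adicCompletion ℚ) from h)
            (ι₂.symm (algebraMap (w.adicCompletion K) (AlgebraicClosure (w.adicCompletion K)) y)) =
          ι₂.symm (algebraMap (w.adicCompletion K) (AlgebraicClosure (w.adicCompletion K)) y)) ∧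
      ∃ c ∈ localSubgroupOfEmb κ.kerSubgroup ι, resGalOfEmb ι c ∉ galRange (K := ℚ) K := by
  obtain ⟨ι, ι₂, hcompat, hf, hfix, τ, hτ⟩ := exists_localSquare_of_eq_span K v₀ w hw hK2
  exact ⟨ι, ι₂, hcompat, hf, hfix, exists_mem_localSubgroupOfEmb_kerSubgroup_not_mem κ ι hp2 (index_galRange_eq_two K hK2) hτ⟩

end Inert

/-! ## §3 The cores data: `N = U.subgroupOf H` versus `H ⊓ U`, inclusions -/

section Cores

variable {G : Type u} [Group G] [TopologicalSpace G] (H U : Subgroup G)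

/-- **The identity `U.subgroupOf H →ₜ* H ⊓ U` over `G` with a continuous section** (both groups are `{g ∈ H | g ∈ U}` with the subspace
topology): the data `(e, he)` / `(einf, heinf, einf', heinf')` of `injTop_of_inputs`. [cite: SerreGaloisCohomology1997, I §2.4] -/
theorem exists_continuousMonoidHom_subgroupOf_inf_pair :
    ∃ (e : (U.subgroupOf H) →ₜ* (H ⊓ U : Subgroup G)) (e' : (H ⊓ U : Subgroup G) →ₜ* (U.subgroupOf H)),
      (∀ x : U.subgroupOf H, ((e x : (H ⊓ U : Subgroup G)) : G) = ((x : H) : G)) ∧ ∀ x, e (e' x) = x :=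
  ⟨{ toFun := fun n ↦ ⟨((n : H) : G), Subgroup.mem_inf.2 ⟨(n : H).2, Subgroup.mem_subgroupOf.1 n.2⟩⟩
     map_one' := rfl
     map_mul' := fun _ _ ↦ rfl
     continuous_toFun := (continuous_subtype_val.comp continuous_subtype_val).subtype_mk _ },
   { toFun := fun x ↦ ⟨⟨(x : G), (Subgroup.mem_inf.1 x.2).1⟩, Subgroup.mem_subgroupOf.2 (Subgroup.mem_inf.1 x.2).2⟩
     map_one' := rfl
     map_mul' := fun _ _ ↦ rfl
     continuous_toFun := (continuous_subtype_val.subtype_mk _).subtype_mk _ },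
   fun _ ↦ rfl, fun _ ↦ rfl⟩

/-- **The inclusion `U.subgroupOf H →ₜ* U.subgroupOf H'` for `H ≤ H'`** over `Subgroup.inclusion`: the data `(incN, hincN)` of
`injTop_of_inputs` (`H = κ.kerSubgroup`, `H' = κ.layerSubgroup n`). [cite: SerreGaloisCohomology1997, I §2.4] -/
theorem exists_continuousMonoidHom_subgroupOf_inclusion {H H' : Subgroup G} (hle : H ≤ H') :
    ∃ inc : (U.subgroupOf H) →ₜ* (U.subgroupOf H'),
      ∀ x : U.subgroupOf H, ((inc x : U.subgroupOf H') : H') = Subgroup.inclusion hle (x : H) :=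
  ⟨{ toFun := fun x ↦ ⟨Subgroup.inclusion hle (x : H), Subgroup.mem_subgroupOf.2 (Subgroup.mem_subgroupOf.1 x.2)⟩
     map_one' := rfl
     map_mul' := fun _ _ ↦ rfl
     continuous_toFun := ((continuous_subtype_val.comp continuous_subtype_val).subtype_mk _).subtype_mk _ },
   fun _ ↦ rfl⟩

end Cores

/-! ## §4 Continuity of the restricted actions on `W[p^∞]` and `W[p]` -/

section Continuity

variable {k : Type u} [Field k] (W : WeierstrassCurve k) (p : ℕ) (H : Subgroup (absoluteGaloisGroup k))

/-- The orbit maps of `H ≤ Γ_k` on `W[p^∞]` are continuous (`hMT`, `hMinf` of `injTop_of_inputs`). [folklore] -/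
theorem continuous_subgroup_smul_geomPrimaryTorsion (m : W.geomPrimaryTorsion p) : Continuous fun g : H ↦ g • m :=
  (W.continuous_smul_geomPrimaryTorsion p m).comp continuous_subtype_val

/-- The orbit maps of `H ≤ Γ_k` on `W[p]` are continuous (`hMpinf` of `injTop_of_inputs`). [folklore] -/
theorem continuous_subgroup_smul_geomTorsion (m : geomTorsion W p) : Continuous fun g : H ↦ g • m := by
  haveI := W.continuousSMul_geomTorsion W.isOpen_stabilizer_point_holds (p : ℤ)
  exact (continuous_id.smul continuous_const : Continuous fun g : absoluteGaloisGroup k ↦ g • m).comp continuous_subtype_val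

end Continuity

end Summit.BirchSwinnertonDyer.BirchSwinnertonDyer.Theorems.SmallImageCharSignedSelmer

end
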